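import Summits.QuantumFields.QCD.Theses.AnomalyRigidity
import Summits.QuantumFields.QCD.Theorems.HeatSlicedQuarksRobustYangMillsHandoverStubAnomalyGermVanishes
import Summits.QuantumFields.QCD.Theorems.HeatSlicedQuarksRobustYangMillsHandoverStubFarMomentsBoundGerm

/-!
# Costume certificate — crux `AnomalousWardTriple` (stmt-QuantumFields-17716), route `AnomalyRigidity` of `QuantumFields/QCD`

Redirect strategist r1 (unit `cstrat-stmt-QuantumFields-17716-r1`, 2026-08-17).  Sorry-free; imports only the route
file and the two LANDED route items `FarMomentsBoundGerm` (stmt-17719, p132696, `stub_farMomentsBoundGerm`) and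
`AnomalyGermVanishes` (stmt-16262, p126118, `stub_anomalyGermVanishes`).

What is certified here (the theorems the STRATEGY-CENSUS cites):

* `awt_iff` — the crux is, DEFINITIONALLY, `∀ N_f ∈ {2,3}, ∃ reg, HasMassScaling ∧ GappedBody reg ∧ WardTripleDataCentered reg`:
  part (a) `GappedBody reg` is the body of the PRE-RETYPE summit conjunct (`QCDOf` before p117723 added the pin
  `IsChiralAtZero`), verbatim, for the same existential witness `reg`; part (b) is the anomaly datum.
* `qcdOf_iff_pinned_gappedBody` — the CURRENT summit conjunct is, definitionally, `∃ reg, HasMassScaling ∧ IsChiralAtZero ∧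
  GappedBody reg`.  So crux (a) = summit conjunct minus the pin, on the nose (`formerQCD_of_awt`, `formerQCDOf_of_qcdOf`).
* `qcd_of_awt_of_gfm : AnomalousWardTriple → UniformGapFarMoments → QCD` — with the two landed items plugged into the
  route's own `closes`, the crux PLUS the rank-3 clustering lemma `UniformGapFarMoments` (stmt-17718, generic
  "uniform lattice gap ⇒ m-uniform far-region L¹ moments", no construction content) already IS the summit.
* `isChiralAtZero_of_gappedBody_of_wardData` — the anomaly mechanism of the route, isolated: for ANY regularisation,
  `GappedBody reg ∧ WardTripleDataCentered reg ∧ UniformGapFarMoments ⇒ reg.IsChiralAtZero` (the only place (b) is ever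
  consumed).  Hence `awt_iff_summitWitnessWithWard`: modulo `UniformGapFarMoments` the crux is EQUIVALENT to
  "a full `QCDOf` witness (scaling ∧ pin ∧ body, i.e. the summit conjunct's own existential package) that moreover carries
  an anomalous Ward triple" — the summit in costume, decorated with an anomaly datum.

Probes (BC2, separate file `Probes.lean`, must FAIL and do): `AnomalousWardTriple → QCD` and `QCD → AnomalousWardTriple`
by `first | exact? | simpa [AnomalousWardTriple] | (unfold AnomalousWardTriple; simpa) | aesop`.
-/

namespace Summit.QuantumFields.QCD.Cruxes.AnomalousWardTriple.Costume

-- the `open` context of the route file `Theses/AnomalyRigidity.lean`, so that the copied crux text elaborates identically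
open scoped BigOperators Topology Manifold Classical MeasureTheory ProbabilityTheory Matrix InnerProductSpace ComplexConjugate ContinuousMap
open Filter Set Function TopologicalSpace MeasureTheory

open Summit.QuantumFields.QCD.Theses.AnomalyRigidity
open Literature.MathematicalPhysics.QuantumFieldTheory
open Summit.QuantumFields.QCD.Cruxes.RobustYangMillsHandover.LeeYangMassHandover
  (stub_anomalyGermVanishes stub_farMomentsBoundGerm)

noncomputable section

variable {Nf : ℕ}

/-! ## §1 The crux, clause by clause (byte-copies of the route text with `reg` free; same as `Lines/birth.lean` §0) -/

/-- **Part (a) of the crux for a GIVEN regularisation** = the body of the pre-retype summit conjunct `QCDOf N_f`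
(before p117723) and the third conjunct of the current one: the gapped `QCDOf` body at every positive tuple. [folklore] -/
def GappedBody (reg : QCDRegularisation Nf) : Prop :=
  open Literature.MathematicalPhysics.QuantumFieldTheory Literature.Probability.LatticeModels in ∀ m : Fin Nf → ℝ, (∀ f, 0 < m f) → ∃ z shift T, IsQCDAlong (reg.scheme m z shift) T ∧ T.IsNontrivial QCDField.glue ∧ T.IsNonGaussian QCDField.glue ∧ (∀ f g : Fin Nf, f ≠ g → T.IsNontrivial (QCDField.pseudoRe f g)) ∧ ∃ Δ > 0, T.HasMassGap Δ ∧ (reg.scheme m z shift).HasLatticeMassGap Δ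

/-- **Part (b) of the crux for a GIVEN regularisation** — centred anomalous Ward-triple data on the degenerate ray
`m ∈ (0, 1]` (the crux text with `reg` free). [cite: KarstenSmit1981] [cite: ColemanGrossman1982] -/
def WardTripleDataCentered (reg : QCDRegularisation Nf) : Prop :=
  open Literature.MathematicalPhysics.QuantumFieldTheory Literature.Probability.LatticeModels in ∃ (V A : Fin 4 → QCDLatticeObservable Nf 1) (P : QCDLatticeObservable Nf 1) (uV uA uP : ℕ → ℝ) (Γ : ℝ → (Fin 4 → ℝ) → (Fin 4 → ℝ) → Fin 4 → Fin 4 → Fin 4 → ℂ) (ΓP : ℝ → (Fin 4 → ℝ) → (Fin 4 → ℝ) → Fin 4 → Fin 4 → ℂ) (c : ℂ) (κ : ℝ), let ph := fun (k : ℕ) (x : Fin 4 → ℤ) (i : Fin 4) => reg.a k * (x i : ℝ); let E := fun (k S : ℕ) (m : ℝ) X => qcdTorusExpect (reg.β k) (2 * S + 1) (fun fl => (reg.scheme (fun _ => m) 0 0).mq fl k) X; let C3 := fun (k S : ℕ) (m : ℝ) (X Y Z : QCDLatticeObservable Nf 1) x y => E k S m (fun U => X.onTorus (2 * S + 1) x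 U * Y.onTorus (2 * S + 1) y U * Z.onTorus (2 * S + 1) 0 U); let F3 := fun (k S : ℕ) (m : ℝ) X Y Z (a b d : ℕ → ℝ) (p q : Fin 4 → ℝ) => ((reg.a k ^ 8 : ℝ) : ℂ) * ∑ x ∈ box 4 S, ∑ y ∈ box 4 S, Complex.exp (Complex.I * ((∑ i : Fin 4, (p i * ph k x i + q i * ph k y i) : ℝ) : ℂ)) * ((a k * b k * d k : ℝ) : ℂ) * C3 k S m X Y Z x y; let O := fun o : Option (Fin 4 ⊕ Unit) => Option.elim o (QCDLatticeObservable.one Nf 1) (Sum.elim V fun _ => P); let w := fun o : Option (Fin 4 ⊕ Unit) => Option.elim o (fun _ => (1 : ℝ)) (Sum.elim (fun _ => uV) fun _ => uP); let R2 := fun (S : ℕ) (X Y : QCDLatticeObservable Nf 1) x y U => Y.osAdjoint.onTorus (2 * S + 1) (siteReflect y) U * X.osAdjoint.onTorus (2 * S + 1) (siteReflect x) U; let P2 := fun (S : ℕ) (X Y : QCDLatticeObservable Nf 1) x y U => X.onTorus (2 * S + 1) x U * Y.onTorus (2 * S + 1) y U; let V8 := (Fin 4 → ℝ) × (Fin 4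 → ℝ); let q2 := fun k : V8 => ‖k‖ ^ 2; let Ev := fun (Q : ℕ → ℕ → Prop) => ∀ᶠ k in Filter.atTop, ∀ S, reg.L k ≤ S → Q k S; c ≠ 0 ∧ 0 < κ ∧ (∀ m : ℝ, 0 < m → m ≤ 1 → ((∀ p q μ ν la, ∀ δ : ℝ, 0 < δ → Ev fun k S => ‖F3 k S m (V μ) (V ν) (A la) uV uV uA p q - Γ m p q μ ν la‖ ≤ δ) ∧ (∀ p q μ ν, ∀ δ : ℝ, 0 < δ → Ev fun k S => ‖F3 k S m (V μ) (V ν) P uV uV uP p q - ΓP m p q μ ν‖ ≤ δ) ∧ (∀ R : Matrix (Fin 4) (Fin 4) ℝ, (∀ i j, R i j = 0 ∨ R i j = 1 ∨ R i j = -1) → R * R.transpose = 1 → ∀ (p q : (Fin 4 → ℝ)) μ ν la, Γ m (R.mulVec p) (R.mulVec q) μ ν la = ((R.det : ℝ) : ℂ) * ∑ μ', ∑ ν', ∑ la', ((R μ μ' * R ν ν' * R la la' : ℝ) : ℂ) * Γ m p q μ' ν' la') ∧ (∀ ν la, (fun k : V8 => ∑ μ : Fin 4, ((k.1 μ : ℝ)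 : ℂ) * Γ m k.1 k.2 μ ν la) =o[𝓝 0] q2) ∧ (∀ μ la, (fun k : V8 => ∑ ν : Fin 4, ((k.2 ν : ℝ) : ℂ) * Γ m k.1 k.2 μ ν la) =o[𝓝 0] q2) ∧ (∀ μ ν la, DifferentiableAt ℝ (fun k : V8 => Γ m k.1 k.2 μ ν la) 0) ∧ (∀ μ ν, (fun k : V8 => (∑ la : Fin 4, ((k.1 la + k.2 la : ℝ) : ℂ) * Γ m k.1 k.2 μ ν la) - ((κ * m : ℝ) : ℂ) * ΓP m k.1 k.2 μ ν - c * ((Matrix.det (Matrix.of ![Pi.single μ 1, Pi.single ν 1, k.1, k.2]) : ℝ) : ℂ)) =o[𝓝 0] q2))) ∧ (∀ Rl : ℝ, 0 < Rl → ∃ C : ℝ, ∀ m : ℝ, 0 < m → m ≤ 1 → ∀ (i j : ℕ), 1 ≤ i → i ≤ 2 → 1 ≤ j → j ≤ 2 → ∀ μ ν : Fin 4, Ev fun k S => (∑ x ∈ box 4 S, ∑ y ∈ box 4 S, if ‖ph k x‖ ≤ Rl ∧ ‖ph k y‖ ≤ Rl then reg.a k ^ 8 * ‖ph k x‖ ^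 i * ‖ph k y‖ ^ j * ‖((uV k * uV k * uP k : ℝ) : ℂ) * C3 k S m (V μ) (V ν) P x y‖ else 0) ≤ C) ∧ (∃ σ : ℝ, σ < 4 ∧ ∀ τ : ℝ, 0 < τ → ∃ C : ℝ, ∀ m : ℝ, 0 < m → m ≤ 1 → ∀ ι₁ ι₂ : Option (Fin 4 ⊕ Unit), Ev fun k S => ∀ x ∈ box 4 S, ∀ y ∈ box 4 S, τ ≤ ph k x 0 → τ ≤ ph k y 0 → ‖ph k x‖ ≤ τ⁻¹ → ‖ph k y‖ ≤ τ⁻¹ → ‖(((w ι₁ k * w ι₂ k) ^ 2 : ℝ) : ℂ) * (E k S m (fun U => R2 S (O ι₁) (O ι₂) x y U * P2 S (O ι₁) (O ι₂) x y U) - E k S m (R2 S (O ι₁) (O ι₂) x y) * E k S m (P2 S (O ι₁) (O ι₂) x y))‖ ≤ C * (reg.a k + ‖ph k x - ph k y‖) ^ (-(2 * σ))) ∧ (∀ m : ℝ, 0 < m → m ≤ 1 → ∀ μ : Fin 4, Ev fun k S => ∀ x ∈ box 4 S, E k S m ((V μ).onTorus (2 * S + 1) x) = 0) ∧ (∀ m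 : ℝ, 0 < m → m ≤ 1 → Ev fun k S => ∀ x ∈ box 4 S, E k S m (P.onTorus (2 * S + 1) x) = 0)

variable (Nf) in
/-- The PRE-RETYPE summit conjunct (the `QCDOf N_f` of before 2026-08-16, p117723): one mass-scaling regularisation
carrying the gapped body at every positive tuple — no pin. [folklore] -/
def FormerQCDOf : Prop :=
  ∃ reg : QCDRegularisation Nf, reg.HasMassScaling ∧ GappedBody reg

/-- The pre-retype summit `QCD` (conjunct of the Clay-grade `QuantumFields` until p117723). [folklore] -/
def FormerQCD : Prop :=
  FormerQCDOf 2 ∧ FormerQCDOf 3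

/-- **The current summit conjunct, clause by clause**: `QCDOf N_f` is DEFINITIONALLY
`∃ reg, HasMassScaling ∧ IsChiralAtZero ∧ GappedBody reg`. [folklore] -/
theorem qcdOf_iff_pinned_gappedBody (Nf : ℕ) :
    QCDOf Nf ↔ ∃ reg : QCDRegularisation Nf, reg.HasMassScaling ∧ reg.IsChiralAtZero ∧ GappedBody reg :=
  Iff.rfl

/-- The current conjunct implies the former one (drop the pin). [folklore] -/
theorem formerQCDOf_of_qcdOf (h : QCDOf Nf) : FormerQCDOf Nf := by
  obtain ⟨reg, hMS, -, hbody⟩ := h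
  exact ⟨reg, hMS, hbody⟩

/-- **The crux, clause by clause**: `AnomalousWardTriple` is DEFINITIONALLY
`∀ N_f ∈ {2,3}, ∃ reg, HasMassScaling ∧ GappedBody reg ∧ WardTripleDataCentered reg`. [folklore] -/
theorem awt_iff :
    AnomalousWardTriple ↔ ∀ Nf : ℕ, Nf = 2 ∨ Nf = 3 →
      ∃ reg : QCDRegularisation Nf, reg.HasMassScaling ∧ GappedBody reg ∧ WardTripleDataCentered reg :=
  Iff.rfl

/-- **COSTUME, first half: the crux contains the pre-retype summit verbatim** — part (a) alone, for the crux's own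
witness regularisation, is the former Clay-grade conjunct for `N_f = 2` and `N_f = 3`. [folklore] -/
theorem formerQCD_of_awt (h : AnomalousWardTriple) : FormerQCD := by
  have main : ∀ Nf : ℕ, Nf = 2 ∨ Nf = 3 → FormerQCDOf Nf := by
    intro Nf hNf
    obtain ⟨reg, hMS, hbody, -⟩ := awt_iff.1 h Nf hNf
    exact ⟨reg, hMS, hbody⟩
  exact ⟨main 2 (Or.inl rfl), main 3 (Or.inr rfl)⟩

/-! ## §2 The summit from the crux and the clustering lemma alone -/

/-- **COSTUME, second half: crux + `UniformGapFarMoments` ⊢ summit**, by the route's own deciding theorem with the two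
LANDED items `stub_farMomentsBoundGerm` (stmt-17719, p132696) and `stub_anomalyGermVanishes` (stmt-16262, p126118)
plugged in.  `UniformGapFarMoments` (stmt-17718, rank 3) is a generic lattice clustering statement with no
construction content; everything the summit asks to CONSTRUCT is inside the crux. [folklore] -/
theorem qcd_of_awt_of_gfm (h2 : AnomalousWardTriple) (h3 : UniformGapFarMoments) : QCD :=
  closes h2 h3 stub_farMomentsBoundGerm stub_anomalyGermVanishes

/-- **The route's anomaly mechanism, isolated and universal in `reg`**: for ANY regularisation (N_f ∈ {2,3}) carrying
the gapped body and a centred anomalous Ward triple, the clustering lemma `UniformGapFarMoments` plus the two landed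
germ items force the pin `IsChiralAtZero` (a uniform gap on the degenerate ray would bound the far moments, hence the
mixed germ of `Γ^P`, and the germ lemma would give `c = 0`).  This is the ONLY use the route makes of part (b); it is
the replay of `closes` with the witness kept. [cite: ColemanGrossman1982] -/
theorem isChiralAtZero_of_gappedBody_of_wardData (h3 : UniformGapFarMoments) (hNf : Nf = 2 ∨ Nf = 3)
    (reg : QCDRegularisation Nf) (hbody : GappedBody reg) (hW : WardTripleDataCentered reg) :
    reg.IsChiralAtZero := by
  obtain ⟨V, A, P, uV, uA, uP, Γ, ΓP, c, κ, hc, hκ, hper, hU1, hU2, hcV, hcP⟩ := hW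
  by_contra hchi
  apply hc
  unfold Literature.MathematicalPhysics.QuantumFieldTheory.QCDRegularisation.IsChiralAtZero at hchi
  push Not at hchi
  obtain ⟨ε, hε, hgap⟩ := hchi
  have hgap' : ∀ m : ℝ, 0 < m → m ≤ 1 →
      (reg.scheme (fun _ : Fin Nf => m) 0 0).HasLatticeMassGap ε :=
    fun m hm _ => hgap (fun _ => m) (fun _ => hm)
  have hbranch : ∀ m : ℝ, 0 < m → m ≤ 1 → ∀ fl : Fin Nf, ∀ᶠ k in Filter.atTop,
      (-1 : ℝ) < (reg.scheme (fun _ : Fin Nf => m) 0 0).mq fl k := by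
    intro m hm _ fl
    obtain ⟨z, shift, T, hT, -⟩ := hbody (fun _ => m) (fun _ => hm)
    exact hT.2.1 fl
  have hAS : (reg.scheme 0 0 0).HasAsymptoticScaling := by
    obtain ⟨z, shift, T, hT, -⟩ := hbody (fun _ => 1) (fun _ => one_pos)
    exact hT.1
  have hfar := h3 Nf reg V P uV uP ε 1 hU2 hε one_pos le_rfl hgap' hbranch hNf hAS hcV hcP
  obtain ⟨K, hK⟩ := stub_farMomentsBoundGerm Nf reg V P uV uP ΓP 1 one_pos le_rfl
    (fun m hm hm1 => (hper m hm hm1).2.1) hU1 hfar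
  exact stub_anomalyGermVanishes Γ ΓP c κ K 1 one_pos hκ.le (fun m hm hm1 =>
    ⟨(hper m hm hm1).2.2.1, (hper m hm hm1).2.2.2.1, (hper m hm hm1).2.2.2.2.1,
      (hper m hm hm1).2.2.2.2.2.1, (hper m hm hm1).2.2.2.2.2.2, hK m hm hm1⟩)

/-- **The crux modulo the clustering lemma = "a full `QCDOf` witness decorated with an anomaly datum"**: given
`UniformGapFarMoments`, `AnomalousWardTriple` is EQUIVALENT to the summit conjunct's own existential package
(scaling ∧ pin ∧ gapped body, cf. `qcdOf_iff_pinned_gappedBody`) carrying, in addition, a centred anomalous Ward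
triple — for both flavour numbers. [folklore] -/
theorem awt_iff_summitWitnessWithWard (h3 : UniformGapFarMoments) :
    AnomalousWardTriple ↔ ∀ Nf : ℕ, Nf = 2 ∨ Nf = 3 →
      ∃ reg : QCDRegularisation Nf,
        reg.HasMassScaling ∧ reg.IsChiralAtZero ∧ GappedBody reg ∧ WardTripleDataCentered reg := by
  constructor
  · intro h Nf hNf
    obtain ⟨reg, hMS, hbody, hW⟩ := awt_iff.1 h Nf hNf
    exact ⟨reg, hMS, isChiralAtZero_of_gappedBody_of_wardData h3 hNf reg hbody hW, hbody, hW⟩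
  · intro h
    refine awt_iff.2 fun Nf hNf => ?_
    obtain ⟨reg, hMS, -, hbody, hW⟩ := h Nf hNf
    exact ⟨reg, hMS, hbody, hW⟩

/-- … and that decorated package projects onto the summit by forgetting the decoration. [folklore] -/
theorem qcd_of_summitWitnessWithWard
    (h : ∀ Nf : ℕ, Nf = 2 ∨ Nf = 3 →
      ∃ reg : QCDRegularisation Nf,
        reg.HasMassScaling ∧ reg.IsChiralAtZero ∧ GappedBody reg ∧ WardTripleDataCentered reg) : QCD := by
  have main : ∀ Nf : ℕ, Nf = 2 ∨ Nf = 3 → QCDOf Nf := by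
    intro Nf hNf
    obtain ⟨reg, hMS, hch, hbody, -⟩ := h Nf hNf
    exact ⟨reg, hMS, hch, hbody⟩
  exact ⟨main 2 (Or.inl rfl), main 3 (Or.inr rfl)⟩

/-- **Distance of the crux from the summit, as one implication chain**:
`QCD ⟸ AWT ∧ GFM` (`qcd_of_awt_of_gfm`) and `AWT ⟹ FormerQCD ⟸ QCD` (`formerQCD_of_awt`, `formerQCDOf_of_qcdOf`):
the crux sits between the former and the current Clay-grade statement, and the gap to the current one is one
generic clustering lemma. [folklore] -/
theorem costume_summary :
    (AnomalousWardTriple → UniformGapFarMoments → QCD) ∧ (AnomalousWardTriple → FormerQCD) ∧ (QCD → FormerQCD) :=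
  ⟨qcd_of_awt_of_gfm, formerQCD_of_awt, fun h => ⟨formerQCDOf_of_qcdOf h.1, formerQCDOf_of_qcdOf h.2⟩⟩

end

end Summit.QuantumFields.QCD.Cruxes.AnomalousWardTriple.Costume
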